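import Summits.Ventures.DiscreteObjects.PP12.OrderThreeCounting

/-!
# PP(12): the fixed structure of a collineation of order 3 — the live `|G| = 3` cell, kernel-typed
Framing: lottery ticket; floor = certified bounds/negative ranges.

**Theorem (`order_three_structure`).** Let `σ ≠ 1` be a collineation of a projective plane of order 12 (Mathlib
`Configuration.ProjectivePlane`) with `σ³ = 1` on points. Then exactly one of:
1. ELATION: an axis `l` (13 fixed points) and a centre `c ∈ l` (13 fixed lines) — in print this case is EXCLUDED
   (Janko–van Trung, *Projective planes of order 12 do not possess an elation of order 3*, Stud. Sci. Math. Hung. 16 (1981)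
   115–118 = AST 2019 Lemma 3.2; NOT re-derived here);
2. PLANAR OF ORDER 3: exactly 13 fixed points and 13 fixed lines, every fixed line carries exactly 4 fixed points and every
   fixed point lies on exactly 4 fixed lines (the fixed structure is a subplane of order 3; `12 = 3² + 3` is Bruck-extremal);
3. GENERALIZED ELATION (flag type): a fixed flag `c ∈ l` such that every fixed point lies on `l` and every fixed line passes
   through `c`, with `f ∈ {1, 4, 7, 10}` fixed points and `g ∈ {1, 4, 7, 10}` fixed lines.
(`f = g` in case 3 is Baer's trace equality, not formalised in this cell; AST 2019 Lemma 3.6 lists exactly these types for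
the elements of their groups of order 9.) This completes, with `Involution.lean` (`p = 2`) and `PrimeOrderSummaryFano`
(`p ≥ 5`), the kernel classification of the fixed structure of every prime-order collineation of a putative projective plane
of order 12; cases 2 and 3 (one conjugacy class of `C₃` each, up to the numerical type) are precisely what the census calls
'beyond bound k' for `|G| = 3` (cell pub-namedobj, target M).

Proof: no case analysis on configurations. Fixed lines carry `k ≡ 13 (mod 3)` fixed points, `k = 13` is an axis and then
`3 ∤ 11` forbids a homology (`CentralCollineation`); otherwise `k, t ∈ {1,4,7,10}` and the flag / point-pair / line-pair
double counts (`FixedIncidenceCounts`), the off-line bounds and the two/three-line inequalities (`OrderThreeCounting`)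
leave, by `order3_arith`, only the planar and the flag patterns, which are then read back geometrically.
-/

namespace Summit.Ventures.DiscreteObjects.PP12

open Configuration Finset
open scoped Classical

namespace Collineation

variable {P L : Type*} [Membership P L] [ProjectivePlane P L] [Fintype P] [Fintype L]
  [DecidableEq P] [DecidableEq L] (σ : Collineation P L)

/-- From the two/three-element inequalities and the off-line bound on a finset `T` with weights `k ∈ {1,4,7,10}`, the
count-form instances consumed by `order3_arith_side`. -/
theorem count_instances {ι : Type*} (T : Finset ι) (k : ι → ℕ) (f : ℕ)
    (two : ∀ m ∈ T, ∀ m' ∈ T, m ≠ m' → k m + k m' ≤ f + 1)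
    (three : ∀ m ∈ T, ∀ m' ∈ T, ∀ m'' ∈ T, m ≠ m' → m ≠ m'' → m' ≠ m'' → k m + k m' + k m'' ≤ f + 3)
    (off : ∀ m ∈ T, f ≤ k m + 12) :
    ((1 ≤ (T.filter fun m => k m = 4).card → f ≤ 16) ∧ (1 ≤ (T.filter fun m => k m = 7).card → f ≤ 19)) ∧
    ((1 ≤ (T.filter fun m => k m = 10).card → 1 ≤ (T.filter fun m => k m = 7).card → 16 ≤ f) ∧
      (2 ≤ (T.filter fun m => k m = 10).card → 19 ≤ f) ∧
      (1 ≤ (T.filter fun m => k m = 7).card → 2 ≤ (T.filter fun m => k m = 4).card → 12 ≤ f) ∧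
      (2 ≤ (T.filter fun m => k m = 7).card → 1 ≤ (T.filter fun m => k m = 4).card → 15 ≤ f) ∧
      (3 ≤ (T.filter fun m => k m = 7).card → 18 ≤ f) ∧
      (1 ≤ (T.filter fun m => k m = 10).card → 2 ≤ (T.filter fun m => k m = 7).card → 21 ≤ f) ∧
      (1 ≤ (T.filter fun m => k m = 10).card → 1 ≤ (T.filter fun m => k m = 7).card →
        1 ≤ (T.filter fun m => k m = 4).card → 18 ≤ f)) := by
  -- extraction helpers
  have one : ∀ j, 1 ≤ (T.filter fun m => k m = j).card → ∃ m ∈ T, k m = j := fun j h => by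
    obtain ⟨m, hm⟩ := Finset.card_pos.mp h
    exact ⟨m, (Finset.mem_filter.mp hm).1, (Finset.mem_filter.mp hm).2⟩
  have two' : ∀ j, 2 ≤ (T.filter fun m => k m = j).card → ∃ m ∈ T, ∃ m' ∈ T, m ≠ m' ∧ k m = j ∧ k m' = j := by
    intro j h
    obtain ⟨m, hm, m', hm', hne⟩ := Finset.one_lt_card.mp h
    exact ⟨m, (Finset.mem_filter.mp hm).1, m', (Finset.mem_filter.mp hm').1, hne, (Finset.mem_filter.mp hm).2,
      (Finset.mem_filter.mp hm').2⟩
  have three' : ∀ j, 3 ≤ (T.filter fun m => k m = j).card →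
      ∃ m ∈ T, ∃ m' ∈ T, ∃ m'' ∈ T, m ≠ m' ∧ m ≠ m'' ∧ m' ≠ m'' ∧ k m = j ∧ k m' = j ∧ k m'' = j := by
    intro j h
    obtain ⟨m, hm, m', hm', m'', hm'', h1, h2, h3⟩ := Finset.two_lt_card.mp h
    exact ⟨m, (Finset.mem_filter.mp hm).1, m', (Finset.mem_filter.mp hm').1, m'', (Finset.mem_filter.mp hm'').1, h1, h2,
      h3, (Finset.mem_filter.mp hm).2, (Finset.mem_filter.mp hm').2, (Finset.mem_filter.mp hm'').2⟩
  refine ⟨⟨fun h => ?_, fun h => ?_⟩, fun h10 h7 => ?_, fun h10 => ?_, fun h7 h4 => ?_, fun h7 h4 => ?_, fun h7 => ?_,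
    fun h10 h7 => ?_, fun h10 h7 h4 => ?_⟩
  · obtain ⟨m, hm, hk⟩ := one 4 h; have := off m hm; omega
  · obtain ⟨m, hm, hk⟩ := one 7 h; have := off m hm; omega
  · obtain ⟨m, hm, hk⟩ := one 10 h10; obtain ⟨m', hm', hk'⟩ := one 7 h7
    have := two m hm m' hm' (fun e => by rw [e] at hk; omega); omega
  · obtain ⟨m, hm, m', hm', hne, hk, hk'⟩ := two' 10 h10
    have := two m hm m' hm' hne; omega
  · obtain ⟨m, hm, hk⟩ := one 7 h7; obtain ⟨m', hm', m'', hm'', hne, hk', hk''⟩ := two' 4 h4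
    have := three m hm m' hm' m'' hm'' (fun e => by rw [e] at hk; omega) (fun e => by rw [e] at hk; omega) hne
    omega
  · obtain ⟨m, hm, m', hm', hne, hk, hk'⟩ := two' 7 h7; obtain ⟨m'', hm'', hk''⟩ := one 4 h4
    have := three m hm m' hm' m'' hm'' hne (fun e => by rw [e] at hk; omega) (fun e => by rw [e] at hk'; omega)
    omega
  · obtain ⟨m, hm, m', hm', m'', hm'', h1, h2, h3, hk, hk', hk''⟩ := three' 7 h7
    have := three m hm m' hm' m'' hm'' h1 h2 h3; omega
  · obtain ⟨m, hm, hk⟩ := one 10 h10; obtain ⟨m', hm', m'', hm'', hne, hk', hk''⟩ := two' 7 h7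
    have := three m hm m' hm' m'' hm'' (fun e => by rw [e] at hk; omega) (fun e => by rw [e] at hk; omega) hne
    omega
  · obtain ⟨m, hm, hk⟩ := one 10 h10; obtain ⟨m', hm', hk'⟩ := one 7 h7; obtain ⟨m'', hm'', hk''⟩ := one 4 h4
    have := three m hm m' hm' m'' hm'' (fun e => by rw [e] at hk; omega) (fun e => by rw [e] at hk; omega)
      (fun e => by rw [e] at hk'; omega)
    omega

/-- If every weight on `T` lies in `{1,4,7,10}`, the multiplicities `c₄,c₇,c₁₀` obey `c₄+c₇+c₁₀ ≤ 1` and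
`3c₄+6c₇+9c₁₀+1 = n`, then some element of a nonempty `T` has weight `≥ n` (it has weight exactly `n`). -/
theorem exists_weight_ge {ι : Type*} (T : Finset ι) (k : ι → ℕ) (n : ℕ) (hT : T.Nonempty)
    (hk : ∀ m ∈ T, k m = 1 ∨ k m = 4 ∨ k m = 7 ∨ k m = 10)
    (h1 : (T.filter fun m => k m = 4).card + (T.filter fun m => k m = 7).card + (T.filter fun m => k m = 10).card ≤ 1)
    (h2 : 3 * (T.filter fun m => k m = 4).card + 6 * (T.filter fun m => k m = 7).card
      + 9 * (T.filter fun m => k m = 10).card + 1 = n) : ∃ m ∈ T, n ≤ k m := by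
  have one : ∀ j, 1 ≤ (T.filter fun m => k m = j).card → ∃ m ∈ T, k m = j := fun j h => by
    obtain ⟨m, hm⟩ := Finset.card_pos.mp h
    exact ⟨m, (Finset.mem_filter.mp hm).1, (Finset.mem_filter.mp hm).2⟩
  by_cases h4 : 1 ≤ (T.filter fun m => k m = 4).card
  · obtain ⟨m, hm, hkm⟩ := one 4 h4; exact ⟨m, hm, by omega⟩
  by_cases h7 : 1 ≤ (T.filter fun m => k m = 7).card
  · obtain ⟨m, hm, hkm⟩ := one 7 h7; exact ⟨m, hm, by omega⟩
  by_cases h10 : 1 ≤ (T.filter fun m => k m = 10).card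
  · obtain ⟨m, hm, hkm⟩ := one 10 h10; exact ⟨m, hm, by omega⟩
  obtain ⟨m, hm⟩ := hT
  refine ⟨m, hm, ?_⟩
  rcases hk m hm with e | e | e | e <;> omega

section OrderTwelveThree

variable (h12 : ProjectivePlane.order P L = 12) (hne : σ.onPoints ≠ 1) (hq : σ.onPoints ^ 3 = 1)
include h12 hne hq

omit [DecidableEq L] hne in
/-- `σ³ = 1`: a fixed line carries `1, 4, 7, 10` or `13` fixed points. -/
theorem fixedOnLine_q3 {l : L} (hl : σ.onLines l = l) :
    σ.fixedOnLine l = 1 ∨ σ.fixedOnLine l = 4 ∨ σ.fixedOnLine l = 7 ∨ σ.fixedOnLine l = 10 ∨ σ.fixedOnLine l = 13 := by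
  haveI : Fact (Nat.Prime 3) := ⟨by norm_num⟩
  have h1 := σ.fixedOnLine_modEq hl hq
  have h2 := σ.fixedOnLine_le l
  rw [h12] at h1 h2
  unfold Nat.ModEq at h1
  omega

omit [DecidableEq L] hne in
/-- `σ³ = 1`, no axis: a fixed line carries `1, 4, 7` or `10` fixed points. -/
theorem fixedOnLine_q3_of_no_axis (hax : ∀ l : L, ¬ σ.IsAxis l) {l : L} (hl : σ.onLines l = l) :
    σ.fixedOnLine l = 1 ∨ σ.fixedOnLine l = 4 ∨ σ.fixedOnLine l = 7 ∨ σ.fixedOnLine l = 10 := by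
  rcases σ.fixedOnLine_q3 h12 hq hl with h | h | h | h | h
  · exact Or.inl h
  · exact Or.inr (Or.inl h)
  · exact Or.inr (Or.inr (Or.inl h))
  · exact Or.inr (Or.inr (Or.inr h))
  · exact absurd (σ.isAxis_of_fixedOnLine_eq (by rw [h, h12])) (hax l)

omit [DecidableEq P] hne in
/-- `σ³ = 1`, no axis: a fixed point lies on `1, 4, 7` or `10` fixed lines (a centre would give an axis). -/
theorem fixedThrough_q3_of_no_axis (hax : ∀ l : L, ¬ σ.IsAxis l) {p : P} (hp : σ.onPoints p = p) :
    σ.fixedThrough p = 1 ∨ σ.fixedThrough p = 4 ∨ σ.fixedThrough p = 7 ∨ σ.fixedThrough p = 10 := by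
  have h12' : ProjectivePlane.order (Dual L) (Dual P) = 12 := by rw [ProjectivePlane.Dual.order]; exact h12
  have hqL : σ.dual.onPoints ^ 3 = 1 := σ.onLines_pow_eq_one hq
  have haxL : ∀ c : Dual P, ¬ σ.dual.IsAxis c := fun c hc => by
    obtain ⟨l, hl⟩ := σ.exists_axis_of_center hc
    exact hax l hl
  rw [fixedThrough_eq_dual]
  exact σ.dual.fixedOnLine_q3_of_no_axis h12' hqL haxL (l := (p : Dual P)) hp

omit [DecidableEq L] in
/-- `σ³ = 1` with an axis: `σ` is an elation (a homology of order 3 would need `3 ∣ 11`). -/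
theorem elation_of_axis_q3 {l : L} (hl : σ.IsAxis l) : ∃ c : P, σ.IsCenter c ∧ c ∈ l := by
  haveI : Fact (Nat.Prime 3) := ⟨by norm_num⟩
  obtain ⟨c, hc⟩ := σ.exists_center_of_axis hl
  refine ⟨c, hc, ?_⟩
  by_contra hcl
  have h := σ.dvd_order_sub_one_of_homology hl hc hcl hne hq
  rw [h12] at h
  revert h; decide

omit hne in
/-- **The no-axis dichotomy**: planar of order 3, or flag type. -/
theorem planar_or_flag_of_no_axis_q3 (hax : ∀ l : L, ¬ σ.IsAxis l) :
    (fixedCard σ.onPoints = 13 ∧ fixedCard σ.onLines = 13 ∧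
      (∀ l : L, σ.onLines l = l → σ.fixedOnLine l = 4) ∧ (∀ p : P, σ.onPoints p = p → σ.fixedThrough p = 4)) ∨
    (∃ (l : L) (c : P), σ.onLines l = l ∧ σ.onPoints c = c ∧ c ∈ l ∧
      (∀ p : P, σ.onPoints p = p → p ∈ l) ∧ (∀ m : L, σ.onLines m = m → c ∈ m) ∧
      (fixedCard σ.onPoints = 1 ∨ fixedCard σ.onPoints = 4 ∨ fixedCard σ.onPoints = 7 ∨ fixedCard σ.onPoints = 10) ∧
      (fixedCard σ.onLines = 1 ∨ fixedCard σ.onLines = 4 ∨ fixedCard σ.onLines = 7 ∨ fixedCard σ.onLines = 10)) := by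
  haveI : Fact (Nat.Prime 3) := ⟨by norm_num⟩
  set S : Finset P := univ.filter fun x : P => σ.onPoints x = x with hS
  set T : Finset L := univ.filter fun m : L => σ.onLines m = m with hT
  have hSdef : fixedCard σ.onPoints = S.card := rfl
  have hTdef : fixedCard σ.onLines = T.card := rfl
  have memS : ∀ {p : P}, p ∈ S ↔ σ.onPoints p = p := by intro p; simp [hS]
  have memT : ∀ {m : L}, m ∈ T ↔ σ.onLines m = m := by intro m; simp [hT]
  -- congruences
  have hf3 : S.card % 3 = 1 := by
    have h := σ.card_fixedPoints_modEq_card hq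
    rw [h12] at h; unfold Nat.ModEq at h; norm_num at h; rw [← hSdef]; omega
  have hg3 : T.card % 3 = 1 := by
    have h : fixedCard σ.onLines ≡ Fintype.card L [MOD 3] := fixedCard_modEq (σ.onLines_pow_eq_one hq)
    rw [ProjectivePlane.card_lines P L, h12] at h; unfold Nat.ModEq at h; norm_num at h; rw [← hTdef]; omega
  -- values
  have hk : ∀ m ∈ T, σ.fixedOnLine m = 1 ∨ σ.fixedOnLine m = 4 ∨ σ.fixedOnLine m = 7 ∨ σ.fixedOnLine m = 10 :=
    fun m hm => σ.fixedOnLine_q3_of_no_axis h12 hq hax (memT.mp hm)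
  have ht : ∀ p ∈ S, σ.fixedThrough p = 1 ∨ σ.fixedThrough p = 4 ∨ σ.fixedThrough p = 7 ∨ σ.fixedThrough p = 10 :=
    fun p hp => σ.fixedThrough_q3_of_no_axis h12 hq hax (memS.mp hp)
  obtain ⟨hSk, hSk2, hSa⟩ := sum_vals_one_four_seven_ten T (fun m => σ.fixedOnLine m) hk
  obtain ⟨hSt, hSt2, hSb⟩ := sum_vals_one_four_seven_ten S (fun p => σ.fixedThrough p) ht
  -- double counts
  have hflag : ∑ p ∈ S, σ.fixedThrough p = ∑ m ∈ T, σ.fixedOnLine m := σ.fixed_flag_count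
  have hpp : ∑ m ∈ T, σ.fixedOnLine m ^ 2 = ∑ p ∈ S, σ.fixedThrough p + S.card * (S.card - 1) :=
    σ.fixed_point_pair_count
  have hlp : ∑ p ∈ S, σ.fixedThrough p ^ 2 = ∑ m ∈ T, σ.fixedOnLine m + T.card * (T.card - 1) :=
    σ.fixed_line_pair_count
  -- off-line bounds and two/three-element inequalities
  have offL : ∀ m ∈ T, S.card ≤ σ.fixedOnLine m + 12 := fun m hm => by
    have h := σ.fixedCard_le_fixedOnLine_add_order (memT.mp hm) (by rw [h12]; rcases hk m hm with e | e | e | e <;> omega)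
    rw [h12] at h; exact h
  have offP : ∀ p ∈ S, T.card ≤ σ.fixedThrough p + 12 := fun p hp => by
    have h := σ.fixedCard_lines_le_fixedThrough_add_order (memS.mp hp)
      (by rw [h12]; rcases ht p hp with e | e | e | e <;> omega)
    rw [h12] at h; exact h
  obtain ⟨hBL, hFL⟩ := count_instances T (fun m => σ.fixedOnLine m) S.card
    (fun m _ m' _ hne' => σ.fixedOnLine_add_le_of_ne hne')
    (fun m _ m' _ m'' _ h1 h2 h3 => σ.fixedOnLine_add_add_le h1 h2 h3) offL
  obtain ⟨hBP, hFP⟩ := count_instances S (fun p => σ.fixedThrough p) T.card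
    (fun p _ p' _ hne' => σ.fixedThrough_add_le_of_ne hne')
    (fun p _ p' _ p'' _ h1 h2 h3 => σ.fixedThrough_add_add_le h1 h2 h3) offP
  -- f, g ≤ 22 (T, S are nonempty by the congruences)
  have hTne : T.Nonempty := Finset.card_pos.mp (by omega)
  have hSne : S.Nonempty := Finset.card_pos.mp (by omega)
  have hf22 : S.card ≤ 22 := by
    obtain ⟨m, hm⟩ := hTne; have := offL m hm; rcases hk m hm with e | e | e | e <;> omega
  have hg22 : T.card ≤ 22 := by
    obtain ⟨p, hp⟩ := hSne; have := offP p hp; rcases ht p hp with e | e | e | e <;> omega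
  -- the two sides of the arithmetic
  have hA := order3_arith_side _ _ _ S.card (by omega) hf3 hf22 hBL hFL
  have hB := order3_arith_side _ _ _ T.card (by omega) hg3 hg22 hBP hFP
  have hB1 : 1 ≤ (T.filter fun m => σ.fixedOnLine m = 1).card → S.card ≤ 13 := fun h => by
    obtain ⟨m, hm⟩ := Finset.card_pos.mp h
    have := offL m (Finset.mem_filter.mp hm).1; rw [(Finset.mem_filter.mp hm).2] at this; omega
  have hB2 : 1 ≤ (S.filter fun p => σ.fixedThrough p = 1).card → T.card ≤ 13 := fun h => by
    obtain ⟨p, hp⟩ := Finset.card_pos.mp h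
    have := offP p (Finset.mem_filter.mp hp).1; rw [(Finset.mem_filter.mp hp).2] at this; omega
  have hmain := order3_arith _ _ _ _ _ _ _ _ S.card T.card hSa hSb (by omega) hA hB hB1 hB2
  rcases hmain with ⟨hf13, hg13, ha1, ha7, ha10, hb1, hb7, hb10⟩ | ⟨hf10, hg10, ha, haf, hb, hbg⟩
  · -- planar of order 3
    refine Or.inl ⟨by rw [hSdef, hf13], by rw [hTdef, hg13], fun l hl => ?_, fun p hp => ?_⟩
    · have hl' : l ∈ T := memT.mpr hl
      have n1 : l ∉ T.filter fun m => σ.fixedOnLine m = 1 := by rw [Finset.card_eq_zero.mp ha1]; simp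
      have n7 : l ∉ T.filter fun m => σ.fixedOnLine m = 7 := by rw [Finset.card_eq_zero.mp ha7]; simp
      have n10 : l ∉ T.filter fun m => σ.fixedOnLine m = 10 := by rw [Finset.card_eq_zero.mp ha10]; simp
      simp only [Finset.mem_filter, hl', true_and] at n1 n7 n10
      rcases hk l hl' with e | e | e | e
      · exact absurd e n1
      · exact e
      · exact absurd e n7
      · exact absurd e n10
    · have hp' : p ∈ S := memS.mpr hp
      have n1 : p ∉ S.filter fun x => σ.fixedThrough x = 1 := by rw [Finset.card_eq_zero.mp hb1]; simp
      have n7 : p ∉ S.filter fun x => σ.fixedThrough x = 7 := by rw [Finset.card_eq_zero.mp hb7]; simp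
      have n10 : p ∉ S.filter fun x => σ.fixedThrough x = 10 := by rw [Finset.card_eq_zero.mp hb10]; simp
      simp only [Finset.mem_filter, hp', true_and] at n1 n7 n10
      rcases ht p hp' with e | e | e | e
      · exact absurd e n1
      · exact e
      · exact absurd e n7
      · exact absurd e n10
  · -- flag type
    -- a fixed line carrying all fixed points
    obtain ⟨l, hlT, hkl⟩ := exists_weight_ge T (fun m => σ.fixedOnLine m) S.card hTne hk ha haf
    have hall : ∀ p : P, σ.onPoints p = p → p ∈ l := by
      intro p hp
      have hsub : (S.filter fun x => x ∈ l) ⊆ S := Finset.filter_subset _ _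
      have hcard : S.card ≤ (S.filter fun x => x ∈ l).card := by rw [← σ.fixedOnLine_eq_card_filter l]; exact hkl
      have heq := Finset.eq_of_subset_of_card_le hsub hcard
      have : p ∈ S.filter fun x => x ∈ l := by rw [heq]; exact memS.mpr hp
      exact (Finset.mem_filter.mp this).2
    -- a fixed point on all fixed lines
    obtain ⟨c, hcS, htc⟩ := exists_weight_ge S (fun p => σ.fixedThrough p) T.card hSne ht hb hbg
    have hall' : ∀ m : L, σ.onLines m = m → c ∈ m := by
      intro m hm
      have hsub : (T.filter fun n => c ∈ n) ⊆ T := Finset.filter_subset _ _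
      have hcard : T.card ≤ (T.filter fun n => c ∈ n).card := by
        have : σ.fixedThrough c = (T.filter fun n => c ∈ n).card := by
          unfold fixedThrough; congr 1; ext n; simp [hT, and_comm]
        rw [← this]; exact htc
      have heq := Finset.eq_of_subset_of_card_le hsub hcard
      have : m ∈ T.filter fun n => c ∈ n := by rw [heq]; exact memT.mpr hm
      exact (Finset.mem_filter.mp this).2
    refine Or.inr ⟨l, c, memT.mp hlT, memS.mp hcS, hall' l (memT.mp hlT), hall, hall', ?_, ?_⟩
    · rw [hSdef]; omega
    · rw [hTdef]; omega

/-- **Fixed structure of a collineation of order 3 of a projective plane of order 12**: elation (13/13; excluded in print,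
JvT 1981), planar of order 3 (13/13, 4 per fixed line and per fixed point), or flag type (all fixed points on a fixed
line `l`, all fixed lines through a fixed point `c ∈ l`, `f, g ∈ {1,4,7,10}`). -/
theorem order_three_structure :
    (∃ (l : L) (c : P), σ.IsAxis l ∧ σ.IsCenter c ∧ c ∈ l ∧ fixedCard σ.onPoints = 13 ∧ fixedCard σ.onLines = 13) ∨
    (fixedCard σ.onPoints = 13 ∧ fixedCard σ.onLines = 13 ∧
      (∀ l : L, σ.onLines l = l → σ.fixedOnLine l = 4) ∧ (∀ p : P, σ.onPoints p = p → σ.fixedThrough p = 4)) ∨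
    (∃ (l : L) (c : P), σ.onLines l = l ∧ σ.onPoints c = c ∧ c ∈ l ∧
      (∀ p : P, σ.onPoints p = p → p ∈ l) ∧ (∀ m : L, σ.onLines m = m → c ∈ m) ∧
      (fixedCard σ.onPoints = 1 ∨ fixedCard σ.onPoints = 4 ∨ fixedCard σ.onPoints = 7 ∨ fixedCard σ.onPoints = 10) ∧
      (fixedCard σ.onLines = 1 ∨ fixedCard σ.onLines = 4 ∨ fixedCard σ.onLines = 7 ∨ fixedCard σ.onLines = 10)) := by
  by_cases hax : ∃ l : L, σ.IsAxis l
  · obtain ⟨l, hl⟩ := hax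
    obtain ⟨c, hc, hcl⟩ := σ.elation_of_axis_q3 h12 hne hq hl
    exact Or.inl ⟨l, c, hl, hc, hcl, by rw [σ.fixedCard_eq_of_elation hl hc hcl hne, h12],
      by rw [σ.fixedCard_lines_eq_of_elation hl hc hcl hne, h12]⟩
  · push Not at hax
    exact Or.inr (σ.planar_or_flag_of_no_axis_q3 h12 hq hax)

end OrderTwelveThree

end Collineation

end Summit.Ventures.DiscreteObjects.PP12
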